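import Summits.PneNP.PneNP.Theorems.Nc03AvoidResidualCoreCandFewHeadsRung

/-!
# Route Nc03AvoidResidualCore — few-heads rung for `CandAvoidLinearFP` (C₁), typed version, part 1/3: decoding the code of a pure `CAND` instance by run-length tokens

Tribunal-w follow-up (D-0033 T3, flag `t3-typing:explicit-avoider`) for `route-PneNP-Nc03AvoidResidualCore`,
item `stmt-PneNP-20226` (`CandAvoidLinearFP = LocalAvoidLinearFP 3 (IsPure candPred)`). The three files
`Nc03AvoidResidualCoreCandFewHeadsRungFP{Decode,Search,}.lean` re-prove the few-heads rung
`Nc03AvoidResidualCoreCandFewHeadsRung.candFewHeads_rung` LITERALLY in the shape of C₁: one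
polynomial-time STRING function (`IsPolyTime`, output read by `readOut`) that solves pure-`CAND`
`NC⁰₃` range avoidance on every instance with at most `k` head variables at stretch `m ≥ (k+1)·n`
(`Nc03AvoidResidualCoreCandFewHeadsRungFP.candFewHeads_rungFP`).

This part: the DECODER. For a pure `CAND` instance the code
`encode I = 1ⁿ0 · 1ᵐ0 · ∏ⱼ (T · 1^{c_j}0 · 1^{a_j}0 · 1^{b_j}0)` has the constant table block
`T = 01010110` (the truth table of `CAND(c; a, b) = c ∧ (a ≠ b)` in the tree's row order), so the
RUN-LENGTH TOKENS of the string — the lengths of the maximal `1`-runs closed by a `0` (`runs`, a left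
fold of `runStep`) — are `n, m, (0, 1, 1, 2, c_j, a_j, b_j)_{j<m}` (`runs_encode`), and output `j` is read
off at token positions `7j+6, 7j+7, 7j+8` (`tripsTok_toks`). No general parser of `LocalMap.encode` is
needed on this sub-family. Part 2 (`…Search`) runs the K1/K3 certificate search on the decoded outputs;
part 3 (`…FP`) types the whole pipeline in the `CodeFP` algebra and states the rung.

Restricted-model algorithmic rung of the range-avoidance ladder; no bearing on `P` versus `NP`.
-/

set_option linter.dupNamespace false -- `Summit.PneNP.PneNP.…`: summit = sub-problem name (D-0017 single-conjunct layout)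

namespace Summit.PneNP.PneNP.Theorems.Nc03AvoidResidualCoreCandFewHeadsRungFP

open Literature.Computability.Complexity

variable {n m : ℕ}

/-! ## Run-length tokens of a bit string -/

/-- One step of the run-length tokenizer; state = (closed run lengths, length of the open run). -/
def runStep (b : Bool) (s : List ℕ × ℕ) : List ℕ × ℕ :=
  if b then (s.1, s.2 + 1) else (s.1 ++ [s.2], 0)

/-- The tokenizer state after reading `w` from state `s`. -/
def runState (w : List Bool) (s : List ℕ × ℕ) : List ℕ × ℕ := w.foldl (fun s b => runStep b s) s

/-- **Run-length tokens**: the lengths of the maximal `1`-runs of `w` that are closed by a `0`, in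
order (an unclosed final run is dropped). -/
def runs (w : List Bool) : List ℕ := (runState w ([], 0)).1

/-- Reading a `1` extends the open run. -/
@[simp] theorem runStep_true (s : List ℕ × ℕ) : runStep true s = (s.1, s.2 + 1) := rfl

/-- Reading a `0` closes the open run (its length becomes a token). -/
@[simp] theorem runStep_false (s : List ℕ × ℕ) : runStep false s = (s.1 ++ [s.2], 0) := rfl

/-- No input: the state is unchanged. -/
theorem runState_nil (s : List ℕ × ℕ) : runState [] s = s := rfl

/-- One more bit = one tokenizer step. -/
theorem runState_cons (b : Bool) (w : List Bool) (s : List ℕ × ℕ) :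
    runState (b :: w) s = runState w (runStep b s) := rfl

/-- Reading a concatenation = reading the two parts in turn. -/
theorem runState_append (u v : List Bool) (s : List ℕ × ℕ) :
    runState (u ++ v) s = runState v (runState u s) :=
  List.foldl_append

/-- A block `1ᵃ` extends the open run by `a`. -/
theorem runState_replicate_true (a : ℕ) (d : List ℕ) (c : ℕ) :
    runState (List.replicate a true) (d, c) = (d, c + a) := by
  induction a generalizing c with
  | zero => rfl
  | succ a ih =>
    rw [List.replicate_succ, runState_cons, runStep_true, ih]
    change (d, c + 1 + a) = (d, c + (a + 1))
    rw [Nat.add_assoc, Nat.add_comm 1 a]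

/-- Reading a unary code `1ᵃ0` closes one run of length `a`. -/
theorem runState_unaryCode (a : ℕ) (d : List ℕ) (w : List Bool) :
    runState (LocalMap.unaryCode a ++ w) (d, 0) = runState w (d ++ [a], 0) := by
  rw [LocalMap.unaryCode, List.append_assoc, runState_append, runState_replicate_true, Nat.zero_add,
    List.singleton_append, runState_cons, runStep_false]

/-! ## The code of a pure `CAND` instance and its tokens -/

/-- The table bits of a `CAND` output (rows `p < 8` ↦ `CAND(bit₀ p; bit₁ p, bit₂ p)`): `01010110`. -/
theorem candTableBits :
    (List.ofFn fun p : Fin (2 ^ 3) => candPred fun i : Fin 3 => p.val.testBit i.val) =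
      [false, true, false, true, false, true, true, false] := by
  decide

/-- The code block of output `j` inside `LocalMap.encode`. -/
def block (I : LocalMap 3 n m) (j : Fin m) : List Bool :=
  (List.ofFn fun p : Fin (2 ^ 3) => I.table j fun i : Fin 3 => p.val.testBit i.val) ++
    (List.ofFn fun i : Fin 3 => LocalMap.unaryCode (I.vars j i).val).flatten

/-- `LocalMap.encode` = the two header codes followed by the per-output blocks. -/
theorem encode_eq (I : LocalMap 3 n m) :
    I.encode = LocalMap.unaryCode n ++ LocalMap.unaryCode m ++ ((List.finRange m).map (block I)).flatten := by
  rw [LocalMap.encode, ← List.ofFn_eq_map]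
  rfl

/-- Flattening a length-`3` `List.ofFn`. -/
theorem flatten_ofFn_three (g : Fin 3 → List Bool) : (List.ofFn g).flatten = g 0 ++ (g 1 ++ (g 2 ++ [])) :=
  rfl

/-- The tokens contributed by output `j`: `0, 1, 1, 2` from the table block, then head, data, data. -/
def blockToks (I : LocalMap 3 n m) (j : Fin m) : List ℕ :=
  [0, 1, 1, 2, (I.vars j 0).val, (I.vars j 1).val, (I.vars j 2).val]

/-- Each output contributes seven tokens. -/
theorem length_blockToks (I : LocalMap 3 n m) (j : Fin m) : (blockToks I j).length = 7 := rfl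

/-- Reading the block of output `j` of a pure `CAND` instance appends its seven tokens. -/
theorem runState_block {I : LocalMap 3 n m} (hI : I.IsPure candPred) (j : Fin m) (d : List ℕ)
    (w : List Bool) : runState (block I j ++ w) (d, 0) = runState w (d ++ blockToks I j, 0) := by
  rw [block, hI.1 j, candTableBits, flatten_ofFn_three]
  simp only [List.cons_append, List.nil_append, List.append_nil, List.append_assoc, runState_cons,
    runStep_false, runStep_true, Nat.zero_add, Nat.reduceAdd]
  rw [runState_unaryCode, runState_unaryCode, runState_unaryCode]
  simp [blockToks]

/-- Reading the blocks of a list of outputs appends their tokens in order. -/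
theorem runState_blocks {I : LocalMap 3 n m} (hI : I.IsPure candPred) (L : List (Fin m)) (d : List ℕ)
    (w : List Bool) :
    runState ((L.map (block I)).flatten ++ w) (d, 0) = runState w (d ++ (L.map (blockToks I)).flatten, 0) := by
  induction L generalizing d with
  | nil => simp
  | cons j L ih =>
    rw [List.map_cons, List.flatten_cons, List.append_assoc, runState_block hI, ih, List.map_cons,
      List.flatten_cons, List.append_assoc]

/-- The token list of a pure `CAND` instance. -/
def toks (I : LocalMap 3 n m) : List ℕ := n :: m :: ((List.finRange m).map (blockToks I)).flatten

/-- **Tokens of the code of a pure `CAND` instance.** -/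
theorem runs_encode {I : LocalMap 3 n m} (hI : I.IsPure candPred) : runs I.encode = toks I := by
  have h : I.encode = LocalMap.unaryCode n ++ (LocalMap.unaryCode m ++
      (((List.finRange m).map (block I)).flatten ++ [])) := by
    rw [encode_eq, List.append_nil, List.append_assoc]
  rw [runs, h, runState_unaryCode, runState_unaryCode, runState_blocks hI]
  simp [runState, toks]

/-! ## Reading the instance off the tokens -/

/-- Token `t` of block `j` sits at position `7j + t` of the flattened block tokens. -/
theorem getD_flatten_blocks (I : LocalMap 3 n m) (d : ℕ) {t : ℕ} (ht : t < 7) :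
    ∀ (L : List (Fin m)) (j : ℕ) (hj : j < L.length),
      ((L.map (blockToks I)).flatten).getD (7 * j + t) d = (blockToks I (L[j])).getD t d := by
  intro L
  induction L with
  | nil => intro j hj; simp at hj
  | cons x L ih =>
    intro j hj
    rw [List.map_cons, List.flatten_cons]
    cases j with
    | zero =>
      rw [Nat.mul_zero, Nat.zero_add, List.getD_append _ _ _ _ (by rw [length_blockToks]; exact ht)]
      rfl
    | succ j =>
      rw [List.getD_append_right _ _ _ _ (by rw [length_blockToks]; omega), length_blockToks,
        show 7 * (j + 1) + t - 7 = 7 * j + t by omega, ih j (by simpa using hj)]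
      rfl

/-- Token `1` is the number of outputs `m`. -/
theorem toks_getD_one (I : LocalMap 3 n m) : (toks I).getD 1 0 = m := rfl

/-- Token `7j + 2 + t` is token `t` of the block of output `j`. -/
theorem toks_getD_field (I : LocalMap 3 n m) (j : Fin m) {t : ℕ} (ht : t < 7) :
    (toks I).getD (7 * j.val + 2 + t) 0 = (blockToks I j).getD t 0 := by
  rw [toks, show 7 * j.val + 2 + t = (7 * j.val + t) + 1 + 1 by omega, List.getD_cons_succ,
    List.getD_cons_succ, getD_flatten_blocks I 0 ht _ _ (by rw [List.length_finRange]; exact j.isLt),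
    List.getElem_finRange]
  rfl

/-- Output `j` as a token triple `(head, data, data)`. -/
def tripTok (ts : List ℕ) (j : ℕ) : ℕ × ℕ × ℕ :=
  (ts.getD (7 * j + 6) 0, ts.getD (7 * j + 7) 0, ts.getD (7 * j + 8) 0)

/-- All outputs, read off the tokens (`m` = token `1`). -/
def tripsTok (ts : List ℕ) : List (ℕ × ℕ × ℕ) := (List.range (ts.getD 1 0)).map (tripTok ts)

/-- Output `j` of the instance as a triple of naturals. -/
def tripOf (I : LocalMap 3 n m) (j : Fin m) : ℕ × ℕ × ℕ :=
  ((I.vars j 0).val, (I.vars j 1).val, (I.vars j 2).val)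

/-- The head component of `tripOf`. -/
@[simp] theorem tripOf_fst (I : LocalMap 3 n m) (j : Fin m) : (tripOf I j).1 = (I.vars j 0).val := rfl

/-- The first data component of `tripOf`. -/
@[simp] theorem tripOf_snd_fst (I : LocalMap 3 n m) (j : Fin m) : (tripOf I j).2.1 = (I.vars j 1).val := rfl

/-- The second data component of `tripOf`. -/
@[simp] theorem tripOf_snd_snd (I : LocalMap 3 n m) (j : Fin m) : (tripOf I j).2.2 = (I.vars j 2).val := rfl

/-- The instance as a list of triples. -/
def trips (I : LocalMap 3 n m) : List (ℕ × ℕ × ℕ) := (List.finRange m).map (tripOf I)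

/-- The triple read off the tokens at output `j` is output `j`. -/
theorem tripTok_toks (I : LocalMap 3 n m) (j : Fin m) : tripTok (toks I) j.val = tripOf I j := by
  simp only [tripTok, tripOf]
  rw [show 7 * j.val + 6 = 7 * j.val + 2 + 4 by omega, toks_getD_field I j (by omega),
    show 7 * j.val + 7 = 7 * j.val + 2 + 5 by omega, toks_getD_field I j (by omega),
    show 7 * j.val + 8 = 7 * j.val + 2 + 6 by omega, toks_getD_field I j (by omega)]
  rfl

/-- **Decoding**: the outputs read off the tokens of the code are the outputs of the instance. -/
theorem tripsTok_toks (I : LocalMap 3 n m) : tripsTok (toks I) = trips I := by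
  rw [tripsTok, toks_getD_one, ← List.map_coe_finRange_eq_range, List.map_map, trips]
  exact List.map_congr_left fun j _ => tripTok_toks I j

end Summit.PneNP.PneNP.Theorems.Nc03AvoidResidualCoreCandFewHeadsRungFP
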